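import Literature.MathematicalPhysics.QuantumFieldTheory.Balaban1983to89.B5G183Zero

/-!
# `Balaban1983to89.B5G183ZeroRate` — the n-UNIFORM LIPSCHITZ RATE at `p′ = 0` of the continued (1.83) fiber of
# `G = Δ₁⁻¹`: `G(p′) = G₀ + O(|p′|)` uniformly in the lattice parameter and in the fiber (a = 1)

T. Bałaban, *Propagators and renormalization transformations for lattice gauge theories. I*,
Commun. Math. Phys. **95**, 17–40 (1984) [Balaban1984PropagatorsI] (cell paper B5), Proposition 1.1, formula (1.83)
p. 31 [PDF 15] and the sentence p. 33 [PDF 17] ll. 1–2 «It can be easily calculated that the values at p′ = 0 agree with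
the second and third equalities in (1.83).»

CITATION HEADER (lean-in-tree rule).  This module is a SUPPLEMENT to the kernel-proved tree modules
`…Balaban1983to89.B5G183Strip` (the continued (1.83) entry symbol `g183 n μ ν l l′ : (Fin d → ℂ) → ℂ`, holomorphic and
bounded by the `d`-only constant `M183 d` on the zero-free strip `Strip d κ`, `0 ≤ κ ≤ κ₁₈₃(d)`, uniformly in `n ≥ 1`
and in the alias indices; `g183_ofReal`: on the punctured real zone it IS the typed fiber matrix entry
`(balabanFiber n hn 1 one_pos s hs hs0).G (l,μ) (l′,ν)`) and `…Balaban1983to89.B5G183Zero` (the VALUE at the origin: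
`g183_at0_eq_G₀ : g183 n μ ν l l′ 0 = G₀ (fun _ ↦ 0) 1 (fun l ↦ Δ(l)) (l,μ) (l′,ν)`, Bałaban's zero fiber, and the
qualitative ε–δ convergence `fiberG_tendsto_G₀`).  Here the convergence is made QUANTITATIVE and UNIFORM IN `n`.

WHAT IS PROVED (every statement `[folklore]`: statements about the cell's own typed objects; `[cite: …]` tags mark
printed TEXT LOCATIONS only — no statement of the paper is used as a hypothesis anywhere):

* §1 (ENGINE, abstract, `[folklore]`) `origin_step`, `origin_telescope`, `origin_lipschitz`: if `g : ℂ^d → ℂ` is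
  (jointly) holomorphic at every point of `Strip d κ = {|Re q_ν| ≤ π, |Im q_ν| ≤ κ}` and `‖g‖ ≤ M` there, with
  `0 < κ` and `3κ ≤ π`, then for every real momentum `s ∈ [−π,π]^d`
  `‖g(s) − g(0)‖ ≤ (M/κ) · Σ_μ |s_μ|`.
  Proof: telescoping over the coordinates (`Finset.piecewise 0`), each step moving ONE real coordinate `s_μ` to `0`:
  if `|s_μ| ≤ π − κ`, Cauchy's Estimate (`Complex.norm_deriv_le_of_forall_mem_sphere_norm_le`) on the INTERIOR
  coordinate discs of radius `κ` centred at the real points `t`, `|t| ≤ π − κ` (such a disc lies in the coordinate box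
  `|Re| ≤ π, |Im| ≤ κ`, so no fat region and no alias covariance is needed) bounds the slice derivative by `M/κ` on the
  real segment, and the mean value inequality on that (convex) segment (`Convex.norm_image_sub_le_of_norm_deriv_le`)
  gives `(M/κ)|s_μ|`; if `|s_μ| > π − κ ≥ 2κ` the trivial bound `2M ≤ (M/κ)|s_μ|` suffices.
* §2 (THE (1.83) SYMBOL) `norm_g183_ofReal_sub_zero_le`: for every `n ≥ 1`, `d`, `μ, ν`, alias indices `l, l′` and
  `s ∈ [−π,π]^d`: `‖g183 n μ ν l l′ (ofRealVec s) − g183 n μ ν l l′ 0‖ ≤ (M183 d / κ₁₈₃ d) · Σ_μ |s_μ|` — the constant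
  depends on `d` ONLY (instantiating §1 with `B5G183Strip.differentiableAt_g183`, `B5G183Strip.norm_g183_le`,
  `κ₁₈₃ ≤ r(d) ≤ 1/4`).
* §3 (THE TYPED FIBER) `norm_fiberG_sub_G₀_le`, `norm_fiberG_sub_G₀_le_norm`: for every `n ≥ 1` and every `s ≠ 0` in
  the zone, `‖(balabanFiber n hn 1 one_pos s hs hs0).G (l,μ) (l′,ν) − G₀ (fun _ ↦ 0) 1 (fun l ↦ Δ(l)) (l,μ) (l′,ν)‖
  ≤ (M183 d / κ₁₈₃ d) · Σ_μ |s_μ| ≤ (d · M183 d / κ₁₈₃ d) · ‖s‖` — `G(p′) = G₀ + O(|p′|)` with an `O` uniform in the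
  lattice parameter `n` and in the fiber: the quantitative, `n`-uniform form of the printed p. 33 sentence at `a = 1`
  (whose qualitative form is `B5G183Zero.fiberG_tendsto_G₀`); `fiberG_tendsto_G₀_uniform` re-derives the ε–δ statement
  with a `δ = δ(ε, d)` INDEPENDENT of `n`.

HONEST SCOPE.  (i) `a = 1`, `U = 1` as in the imported modules; general `a` is the one-line conjugation recorded in
`B5Prop11Bound`.  (ii) The constant `M183 d / κ₁₈₃ d` is explicit but not optimised.  (iii) This is a statement about
the ENTRIES of the fiber matrices at fixed alias indices (the operator-norm / alias-summed version is the consumer's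
bookkeeping with the `d`-only alias weights of `B5Prop11Bound`).  (iv) Junk values: none — `Fiber.G` is only
evaluated at `s ≠ 0`, where it is the printed matrix, and `g183` at the honest origin value of `B5G183Zero`.  (v) A
kernel certificate of the cell's own regrouped objects; NOT a claim about the continuum limit, NOT summit progress.
-/

noncomputable section

open scoped BigOperators ComplexConjugate Topology
open Finset Complex Filter Metric Set

namespace Literature.MathematicalPhysics.QuantumFieldTheory.Balaban1983to89.B5G183ZeroRate

open Literature.MathematicalPhysics.QuantumFieldTheory.Balaban1983to89.B4Strip
open Literature.MathematicalPhysics.QuantumFieldTheory.Balaban1983to89.B4StripCauchy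
open Literature.MathematicalPhysics.QuantumFieldTheory.Balaban1983to89.B4ContourShift
open Literature.MathematicalPhysics.QuantumFieldTheory.Balaban1983to89.B5Strip145Analytic
open Literature.MathematicalPhysics.QuantumFieldTheory.Balaban1983to89.B5Prop11Leaves
open Literature.MathematicalPhysics.QuantumFieldTheory.Balaban1983to89.B5Prop11Fiber
open Literature.MathematicalPhysics.QuantumFieldTheory.Balaban1983to89.B5Prop11Bound
open Literature.MathematicalPhysics.QuantumFieldTheory.Balaban1983to89.B5G183Strip
open Literature.MathematicalPhysics.QuantumFieldTheory.Balaban1983to89.B5G183Zero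

variable {d : ℕ}

/-! ## §1. ENGINE: Lipschitz rate toward the origin from holomorphy and a bound on a strip -/

/-- a closed disc of radius `κ` centred at a REAL point `t` with `|t| ≤ π − κ` lies in the coordinate box
`|Re| ≤ π, |Im| ≤ κ` (`B4StripCauchy.Box κ`). [folklore] -/
theorem closedBall_subset_box {κ : ℝ} {z : ℂ} (hz : |z.re| ≤ Real.pi - κ ∧ z.im = 0) {w : ℂ}
    (hw : w ∈ closedBall z κ) : w ∈ Box κ := by
  rw [mem_closedBall, dist_eq_norm] at hw
  have hre : |(w - z).re| ≤ ‖w - z‖ := abs_re_le_norm _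
  have him : |(w - z).im| ≤ ‖w - z‖ := abs_im_le_norm _
  simp only [sub_re, sub_im] at hre him
  have e1 := abs_sub_abs_le_abs_sub w.re z.re
  have e2 := abs_sub_abs_le_abs_sub w.im z.im
  have hz2 : |z.im| = 0 := by rw [hz.2, abs_zero]
  exact ⟨by linarith [hz.1], by linarith⟩

/-- the real coordinate segment `{z : |Re z| ≤ π − κ, Im z = 0}` is convex. [folklore] -/
theorem convex_realSeg (κ : ℝ) : Convex ℝ {z : ℂ | |z.re| ≤ Real.pi - κ ∧ z.im = 0} := by
  have hTeq : {z : ℂ | |z.re| ≤ Real.pi - κ ∧ z.im = 0} =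
      ({z : ℂ | -(Real.pi - κ) ≤ z.re} ∩ {z : ℂ | z.re ≤ Real.pi - κ}) ∩
        ({z : ℂ | z.im ≤ 0} ∩ {z : ℂ | 0 ≤ z.im}) := by
    ext z
    simp only [Set.mem_setOf_eq, Set.mem_inter_iff, abs_le, le_antisymm_iff]
  rw [hTeq]
  exact ((convex_halfSpace_re_ge _).inter (convex_halfSpace_re_le _)).inter
    ((convex_halfSpace_im_le _).inter (convex_halfSpace_im_ge _))

/-- the real coordinate segment lies in the coordinate box (for `0 ≤ κ`). [folklore] -/
theorem realSeg_subset_box {κ : ℝ} (hκ : 0 ≤ κ) {z : ℂ} (hz : |z.re| ≤ Real.pi - κ ∧ z.im = 0) : z ∈ Box κ :=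
  ⟨by linarith [hz.1], by rw [hz.2, abs_zero]; exact hκ⟩

/-- ONE COORDINATE TO ZERO: joint holomorphy and the bound `M` on `Strip d κ` (`0 < κ`, `3κ ≤ π`) give, for a strip
point `q` whose `μ`-th coordinate is REAL, `‖g q − g (q with q_μ ↦ 0)‖ ≤ (M/κ)‖q_μ‖` — Cauchy's Estimate on interior
coordinate discs + the mean value inequality on the real segment when `|q_μ| ≤ π − κ`, the trivial bound `2M` when
`|q_μ| > π − κ ≥ 2κ`. [folklore] -/
theorem origin_step (g : (Fin d → ℂ) → ℂ) {κ M : ℝ} (hκ : 0 < κ) (hκ3 : 3 * κ ≤ Real.pi)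
    (hdiff : ∀ q ∈ Strip d κ, DifferentiableAt ℂ g q) (hbound : ∀ q ∈ Strip d κ, ‖g q‖ ≤ M)
    {q : Fin d → ℂ} (hq : q ∈ Strip d κ) (μ : Fin d) (hreal : (q μ).im = 0) :
    ‖g q - g (Function.update q μ 0)‖ ≤ M / κ * ‖q μ‖ := by
  have hM : 0 ≤ M := (norm_nonneg _).trans (hbound q hq)
  have hMκ : 0 ≤ M / κ := div_nonneg hM hκ.le
  have h0seg : |(0 : ℂ).re| ≤ Real.pi - κ ∧ (0 : ℂ).im = 0 := by
    refine ⟨?_, Complex.zero_im⟩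
    rw [Complex.zero_re, abs_zero]; linarith
  have hq0 : Function.update q μ 0 ∈ Strip d κ := update_mem_strip hq μ (realSeg_subset_box hκ.le h0seg)
  by_cases hfar : Real.pi - κ < |(q μ).re|
  · -- far case: the trivial bound
    have h2κ : 2 * κ ≤ ‖q μ‖ := by
      have := abs_re_le_norm (q μ)
      linarith
    calc ‖g q - g (Function.update q μ 0)‖ ≤ ‖g q‖ + ‖g (Function.update q μ 0)‖ := norm_sub_le _ _
      _ ≤ M + M := add_le_add (hbound q hq) (hbound _ hq0)
      _ = M / κ * (2 * κ) := by field_simp; ring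
      _ ≤ M / κ * ‖q μ‖ := mul_le_mul_of_nonneg_left h2κ hMκ
  · -- near case: Cauchy's Estimate + mean value along the real segment
    push Not at hfar
    have hyseg : |(q μ).re| ≤ Real.pi - κ ∧ (q μ).im = 0 := ⟨hfar, hreal⟩
    set f : ℂ → ℂ := fun w => g (Function.update q μ w) with hf
    have hdiffT : ∀ z ∈ {z : ℂ | |z.re| ≤ Real.pi - κ ∧ z.im = 0}, DifferentiableAt ℂ f z := by
      intro z hz
      exact (hdiff _ (update_mem_strip hq μ (realSeg_subset_box hκ.le hz))).comp z
        (differentiableAt_update q μ z)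
    have hderivT : ∀ z ∈ {z : ℂ | |z.re| ≤ Real.pi - κ ∧ z.im = 0}, ‖deriv f z‖ ≤ M / κ := by
      intro z hz
      apply Complex.norm_deriv_le_of_forall_mem_sphere_norm_le hκ
      · refine DifferentiableOn.diffContOnCl_ball ?_ (subset_refl (closedBall z κ))
        intro w hw
        exact ((hdiff _ (update_mem_strip hq μ (closedBall_subset_box hz hw))).comp w
          (differentiableAt_update q μ w)).differentiableWithinAt
      · intro w hw
        exact hbound _ (update_mem_strip hq μ (closedBall_subset_box hz (sphere_subset_closedBall hw)))
    have key := (convex_realSeg κ).norm_image_sub_le_of_norm_deriv_le hdiffT hderivT h0seg hyseg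
    have h1 : f (q μ) = g q := by simp [hf]
    have h0 : f 0 = g (Function.update q μ 0) := by simp [hf]
    rw [h1, h0, sub_zero] at key
    exact key

/-- TELESCOPING over the coordinates toward the origin (`Finset.piecewise 0` zeroes the coordinates in `S`). [folklore] -/
theorem origin_telescope (g : (Fin d → ℂ) → ℂ) {κ M : ℝ} (hκ : 0 < κ) (hκ3 : 3 * κ ≤ Real.pi)
    (hdiff : ∀ q ∈ Strip d κ, DifferentiableAt ℂ g q) (hbound : ∀ q ∈ Strip d κ, ‖g q‖ ≤ M)
    (s : Fin d → ℝ) (hs : ∀ μ, |s μ| ≤ Real.pi) (S : Finset (Fin d)) :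
    ‖g (ofRealVec s) - g (S.piecewise 0 (ofRealVec s))‖ ≤ M / κ * ∑ μ ∈ S, |s μ| := by
  induction S using Finset.induction_on with
  | empty => simp [Finset.piecewise_empty]
  | insert μ S hμ ih =>
    have hq : S.piecewise 0 (ofRealVec s) ∈ Strip d κ := by
      intro ν
      by_cases hν : ν ∈ S
      · rw [Finset.piecewise_eq_of_mem _ _ _ hν]
        simp only [Pi.zero_apply, Complex.zero_re, Complex.zero_im, abs_zero]
        exact ⟨Real.pi_pos.le, hκ.le⟩
      · rw [Finset.piecewise_eq_of_notMem _ _ _ hν]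
        simp only [ofRealVec, ofReal_re, ofReal_im, abs_zero]
        exact ⟨hs ν, hκ.le⟩
    have hre : ((S.piecewise 0 (ofRealVec s)) μ).im = 0 := by
      rw [Finset.piecewise_eq_of_notMem _ _ _ hμ]; simp [ofRealVec]
    have step := origin_step g hκ hκ3 hdiff hbound hq μ hre
    rw [Finset.piecewise_eq_of_notMem _ _ _ hμ] at step
    have hnorm : ‖ofRealVec s μ‖ = |s μ| := by
      simp only [ofRealVec, Complex.norm_real, Real.norm_eq_abs]
    rw [hnorm] at step
    rw [Finset.piecewise_insert, Finset.sum_insert hμ, Pi.zero_apply]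
    calc ‖g (ofRealVec s) - g (Function.update (S.piecewise 0 (ofRealVec s)) μ 0)‖
        ≤ ‖g (ofRealVec s) - g (S.piecewise 0 (ofRealVec s))‖
          + ‖g (S.piecewise 0 (ofRealVec s)) - g (Function.update (S.piecewise 0 (ofRealVec s)) μ 0)‖ :=
          norm_sub_le_norm_sub_add_norm_sub _ _ _
      _ ≤ M / κ * ∑ x ∈ S, |s x| + M / κ * |s μ| := add_le_add ih step
      _ = M / κ * (|s μ| + ∑ x ∈ S, |s x|) := by ring

/-- **THE ABSTRACT ORIGIN-LIPSCHITZ LEMMA**: joint holomorphy and the bound `M` on `Strip d κ` (`0 < κ`, `3κ ≤ π`)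
give, for every real momentum `s ∈ [−π,π]^d`, `‖g(s) − g(0)‖ ≤ (M/κ) · Σ_μ |s_μ|`. [folklore] -/
theorem origin_lipschitz (g : (Fin d → ℂ) → ℂ) {κ M : ℝ} (hκ : 0 < κ) (hκ3 : 3 * κ ≤ Real.pi)
    (hdiff : ∀ q ∈ Strip d κ, DifferentiableAt ℂ g q) (hbound : ∀ q ∈ Strip d κ, ‖g q‖ ≤ M)
    (s : Fin d → ℝ) (hs : ∀ μ, |s μ| ≤ Real.pi) :
    ‖g (ofRealVec s) - g 0‖ ≤ M / κ * ∑ μ, |s μ| := by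
  have := origin_telescope g hκ hκ3 hdiff hbound s hs Finset.univ
  rwa [Finset.piecewise_univ] at this

/-- `Σ_μ |s_μ| ≤ d · ‖s‖` (sup norm). [folklore] -/
theorem sum_abs_le_card_mul_norm (s : Fin d → ℝ) : ∑ μ, |s μ| ≤ (d : ℝ) * ‖s‖ := by
  calc ∑ μ, |s μ| ≤ ∑ _μ : Fin d, ‖s‖ := Finset.sum_le_sum fun μ _ => by
          rw [← Real.norm_eq_abs]; exact norm_le_pi_norm s μ
    _ = (d : ℝ) * ‖s‖ := by simp

/-! ## §2. The (1.83) entry symbol: `‖g183(s) − g183(0)‖ ≤ (M183 d / κ₁₈₃ d) Σ_μ |s_μ|`, uniformly in `n` -/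

/-- `0 ≤ M183 d` (`= MD183 + Mmid183·MB183²`). [folklore] -/
theorem M183_nonneg (d : ℕ) : 0 ≤ M183 d := by
  unfold M183
  rw [mul_assoc]
  exact add_nonneg (MD183_nonneg d) (mul_nonneg (Mmid183_nonneg d) (mul_self_nonneg (MB183 d)))

/-- `3 κ₁₈₃(d) ≤ π` (indeed `κ₁₈₃ ≤ r(d) ≤ 1/4`). [folklore] -/
theorem three_kappa183_le_pi (d : ℕ) : 3 * kappa183 d ≤ Real.pi := by
  have h1 : kappa183 d ≤ 1 / 4 := (kappa183_le_rOf d).trans (rOf_le d)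
  have h2 : (3 : ℝ) ≤ Real.pi := by linarith [Real.pi_gt_three]
  linarith

/-- **n-UNIFORM LIPSCHITZ RATE OF THE CONTINUED (1.83) ENTRY SYMBOL AT THE ORIGIN**: for every `n ≥ 1`, all `μ, ν`,
all alias indices `l, l′` and every `s ∈ [−π,π]^d`,
`‖g183 n μ ν l l′ (s) − g183 n μ ν l l′ (0)‖ ≤ (M183 d / κ₁₈₃ d) · Σ_μ |s_μ|` — the constant depends on `d` only.
[folklore] -/
theorem norm_g183_ofReal_sub_zero_le (n : ℕ) [NeZero n] (μ ν : Fin d) (k k' : Fin d → Fin n)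
    (s : Fin d → ℝ) (hs : ∀ μ, |s μ| ≤ Real.pi) :
    ‖g183 n μ ν k k' (ofRealVec s) - g183 n μ ν k k' 0‖ ≤ M183 d / kappa183 d * ∑ μ, |s μ| :=
  origin_lipschitz (fun q => g183 n μ ν k k' q) (kappa183_pos d) (three_kappa183_le_pi d)
    (fun _ hq => differentiableAt_g183 n (kappa183_pos d).le le_rfl hq μ ν k k')
    (fun _ hq => norm_g183_le n (kappa183_pos d).le le_rfl hq μ ν k k') s hs

/-- the same with the zero value identified as Bałaban's zero fiber `G₀` (`B5G183Zero.g183_at0_eq_G₀`). [folklore] -/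
theorem norm_g183_ofReal_sub_G₀_le (n : ℕ) [NeZero n] (μ ν : Fin d) (k k' : Fin d → Fin n)
    (s : Fin d → ℝ) (hs : ∀ μ, |s μ| ≤ Real.pi) :
    ‖g183 n μ ν k k' (ofRealVec s)
        - G₀ (fun _ => (0 : Fin n)) 1 (fun l => DeltaXir n 0 (shiftr n l (0 : Fin d → ℝ))) (k, μ) (k', ν)‖
      ≤ M183 d / kappa183 d * ∑ μ, |s μ| := by
  rw [← g183_at0_eq_G₀ n μ ν k k']
  exact norm_g183_ofReal_sub_zero_le n μ ν k k' s hs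

/-! ## §3. The typed (1.83) fiber matrix: `G(p′) = G₀ + O(|p′|)` uniformly in `n` (B5 p. 33 ll. 1–2, quantitative) -/

/-- **THE PRINTED p. 33 SENTENCE, QUANTITATIVE AND UNIFORM IN THE LATTICE PARAMETER (a = 1)**: for every `n ≥ 1`, all
`μ, ν`, all alias indices `l, l′` and every `s ≠ 0` in `[−π,π]^d`, the `((l,μ),(l′,ν))` entry of the TYPED fiber
matrix (1.83) of `G = Δ₁⁻¹` (`B5Prop11Bound.Fiber.G` on `B5Prop11Fiber.balabanFiber`) differs from the corresponding
entry of Bałaban's zero fiber `G₀ = diag(1 at l = 0, Δ(l)⁻¹ else)` (the second and third equalities of (1.83)) by at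
most `(M183 d / κ₁₈₃ d) · Σ_μ |s_μ|`.  [cite: Balaban1984PropagatorsI, text p.33 ll.1–2 with (1.83) p.31 (text only;
the estimate is ours)] [folklore] -/
theorem norm_fiberG_sub_G₀_le (n : ℕ) [NeZero n] (hn : 1 ≤ n) (μ ν : Fin d) (k k' : Fin d → Fin n)
    (s : Fin d → ℝ) (hs : ∀ μ, |s μ| ≤ Real.pi) (hs0 : s ≠ 0) :
    ‖(balabanFiber n hn 1 one_pos s hs hs0).G (k, μ) (k', ν)
        - G₀ (fun _ => (0 : Fin n)) 1 (fun l => DeltaXir n 0 (shiftr n l (0 : Fin d → ℝ))) (k, μ) (k', ν)‖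
      ≤ M183 d / kappa183 d * ∑ μ, |s μ| := by
  rw [← g183_ofReal n hn s hs hs0 μ ν k k']
  exact norm_g183_ofReal_sub_G₀_le n μ ν k k' s hs

/-- the same in the sup norm of the momentum: `‖G(s)_{(l,μ),(l′,ν)} − (G₀)_{(l,μ),(l′,ν)}‖ ≤ (d·M183 d/κ₁₈₃ d)·‖s‖`.
[folklore] -/
theorem norm_fiberG_sub_G₀_le_norm (n : ℕ) [NeZero n] (hn : 1 ≤ n) (μ ν : Fin d) (k k' : Fin d → Fin n)
    (s : Fin d → ℝ) (hs : ∀ μ, |s μ| ≤ Real.pi) (hs0 : s ≠ 0) :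
    ‖(balabanFiber n hn 1 one_pos s hs hs0).G (k, μ) (k', ν)
        - G₀ (fun _ => (0 : Fin n)) 1 (fun l => DeltaXir n 0 (shiftr n l (0 : Fin d → ℝ))) (k, μ) (k', ν)‖
      ≤ (d : ℝ) * M183 d / kappa183 d * ‖s‖ := by
  have hC : 0 ≤ M183 d / kappa183 d := div_nonneg (M183_nonneg d) (kappa183_pos d).le
  calc _ ≤ M183 d / kappa183 d * ∑ μ, |s μ| := norm_fiberG_sub_G₀_le n hn μ ν k k' s hs hs0
    _ ≤ M183 d / kappa183 d * ((d : ℝ) * ‖s‖) :=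
        mul_le_mul_of_nonneg_left (sum_abs_le_card_mul_norm s) hC
    _ = (d : ℝ) * M183 d / kappa183 d * ‖s‖ := by ring

/-- the ε–δ convergence of `B5G183Zero.fiberG_tendsto_G₀` re-derived with a modulus `δ = δ(ε, d)` INDEPENDENT of the
lattice parameter `n` (and of `μ, ν, l, l′`). [folklore] -/
theorem fiberG_tendsto_G₀_uniform (d : ℕ) :
    ∀ ε > 0, ∃ δ > 0, ∀ (n : ℕ) [NeZero n] (hn : 1 ≤ n) (μ ν : Fin d) (k k' : Fin d → Fin n)
      (s : Fin d → ℝ) (hs : ∀ μ, |s μ| ≤ Real.pi) (hs0 : s ≠ 0), ‖s‖ < δ →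
      ‖(balabanFiber n hn 1 one_pos s hs hs0).G (k, μ) (k', ν)
          - G₀ (fun _ => (0 : Fin n)) 1 (fun l => DeltaXir n 0 (shiftr n l (0 : Fin d → ℝ))) (k, μ) (k', ν)‖ < ε := by
  intro ε hε
  have hC0 : 0 ≤ (d : ℝ) * M183 d / kappa183 d :=
    div_nonneg (mul_nonneg (Nat.cast_nonneg d) (M183_nonneg d)) (kappa183_pos d).le
  refine ⟨ε / ((d : ℝ) * M183 d / kappa183 d + 1), div_pos hε (by linarith), ?_⟩
  intro n _ hn μ ν k k' s hs hs0 hsδ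
  have h1 := norm_fiberG_sub_G₀_le_norm n hn μ ν k k' s hs hs0
  have h2 : (d : ℝ) * M183 d / kappa183 d * ‖s‖
      ≤ (d : ℝ) * M183 d / kappa183 d * (ε / ((d : ℝ) * M183 d / kappa183 d + 1)) :=
    mul_le_mul_of_nonneg_left hsδ.le hC0
  have h3 : (d : ℝ) * M183 d / kappa183 d * (ε / ((d : ℝ) * M183 d / kappa183 d + 1)) < ε := by
    set C : ℝ := (d : ℝ) * M183 d / kappa183 d
    rw [mul_div_assoc', div_lt_iff₀ (by linarith)]
    nlinarith
  linarith

end Literature.MathematicalPhysics.QuantumFieldTheory.Balaban1983to89.B5G183ZeroRate
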